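import Summits.ResolutionOfSingularities.ResolutionOfSingularities.Theorems.WildDescent2
import HarnessLib

/-!
# WildDescent (3/13) — β-descent in a linear frame; §2 Frame polynomials (`δ > 1`), IsolationLaw (L5 `exists_fst_lt_one`)

Verbatim slice of the farm-checked monolith `WildDescent.lean` of cell `decomp-res`, seat `decomp-res-lens-5`, g36
(sha256 4ec0fa6f4f9efba7…); one namespace `Summit.ResolutionOfSingularities.ResolutionOfSingularities.Theorems.WildDescent` across the
slices, imports chained (laws L1–L7 and the mechanism: module docstring of slice 1; main theorems: slice 13/13).
-/

open MvPolynomial Finset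
open scoped BigOperators
open Literature.AlgebraicGeometry.Resolution
open Literature.AlgebraicGeometry.Resolution.Hauser2010
open Literature.AlgebraicGeometry.Resolution.PointBlowup
open Literature.AlgebraicGeometry.Resolution.HauserPerlega2024

namespace Summit.ResolutionOfSingularities.ResolutionOfSingularities.Theorems.WildDescent

/-! ## §2 Frame polynomials: `in_s H = c·y_f^s`, `ord H = s`; the level-`s` structure, `δ > 1`, and the ISOLATION LAW -/

section Frame

variable {K : Type*} [Field K]

/-- Monomials of a polynomial of order `≥ s` have degree `≥ s`. [folklore] -/
theorem le_degree_of_mem_support {σ : Type*} {H : MvPolynomial σ K} {s : ℕ} (hord : (s : ℕ∞) ≤ ordZero H)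
    {d : σ →₀ ℕ} (hd : d ∈ H.support) : s ≤ d.degree := by
  by_contra hlt
  exact (mem_support_iff.mp hd) ((natCast_le_ordZero_iff_forall_coeff H s).mp hord d (not_le.mp hlt))

/-- In a frame polynomial the only degree-`s` monomial is `y_f^s`. [folklore] -/
theorem eq_single_of_degree_eq {σ : Type*} {H : MvPolynomial σ K} {s : ℕ} {f : σ} {c : K}
    (hin : homogeneousComponent s H = C c * X f ^ s) {d : σ →₀ ℕ} (hd : d ∈ H.support) (hdeg : d.degree = s) :
    d = Finsupp.single f s := by
  classical
  have h := mem_support_iff.mp hd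
  have h2 : coeff d (homogeneousComponent s H) = coeff d H := by rw [coeff_homogeneousComponent, if_pos hdeg]
  rw [← h2, hin, X_pow_eq_monomial, coeff_C_mul, coeff_monomial] at h
  by_contra hne
  rw [if_neg (Ne.symm hne), mul_zero] at h
  exact h rfl

/-- … and `y_f^s` does occur. [folklore] -/
theorem single_mem_support {σ : Type*} {H : MvPolynomial σ K} {s : ℕ} {f : σ} {c : K}
    (hin : homogeneousComponent s H = C c * X f ^ s) (hc : c ≠ 0) : Finsupp.single f s ∈ H.support := by
  classical
  rw [mem_support_iff]
  have h2 : coeff (Finsupp.single f s) (homogeneousComponent s H) = coeff (Finsupp.single f s) H := by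
    rw [coeff_homogeneousComponent, if_pos (Finsupp.degree_single f s)]
  rw [← h2, hin, X_pow_eq_monomial, coeff_C_mul, coeff_monomial, if_pos rfl, mul_one]
  exact hc

/-- Degree of an exponent in three exhausting letters. [folklore] -/
theorem degree_eq_three {σ : Type*} {f u v : σ} (hfu : f ≠ u) (hfv : f ≠ v) (huv : u ≠ v)
    (hσ : ∀ i, i = f ∨ i = u ∨ i = v) (d : σ →₀ ℕ) : d.degree = d f + d u + d v := by
  classical
  have hsub : d.support ⊆ ({f, u, v} : Finset σ) := fun i _ => by
    rcases hσ i with rfl | rfl | rfl <;> simp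
  rw [Finsupp.degree_apply, Finset.sum_subset hsub (fun i _ hi => Finsupp.notMem_support_iff.mp hi),
    Finset.sum_insert (by simp [hfu, hfv]), Finset.sum_insert (by simp [huv]), Finset.sum_singleton, add_assoc]

/-- **`δ > 1`:** every point of the point set of a frame polynomial has coordinate sum `> 1` (the monomials other
than `y_f^s` have degree `> s`). [cite: CossartJannsenSaito2020, Thm 8.16/Def 8.1 pp.107–114] -/
theorem one_lt_add_of_mem_pts {σ : Type*} {H : MvPolynomial σ K} {s : ℕ} {f u v : σ} {c : K} (hfu : f ≠ u) (hfv : f ≠ v)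
    (huv : u ≠ v) (hσ : ∀ i, i = f ∨ i = u ∨ i = v) (hin : homogeneousComponent s H = C c * X f ^ s)
    (hord : (s : ℕ∞) ≤ ordZero H) {x : ℚ × ℚ} (hx : x ∈ pts s f u v H) : 1 < x.1 + x.2 := by
  classical
  obtain ⟨d, hd, hdf, rfl⟩ := mem_pts.mp hx
  have hs := le_degree_of_mem_support hord hd
  have hne : d.degree ≠ s := fun h => by
    have := eq_single_of_degree_eq hin hd h
    rw [this, Finsupp.single_eq_same] at hdf
    exact lt_irrefl _ hdf
  have hgt : s < d.degree := lt_of_le_of_ne hs (Ne.symm hne)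
  rw [degree_eq_three hfu hfv huv hσ] at hgt
  unfold pt
  simp only
  have hlt : ((d f : ℕ) : ℚ) < (s : ℚ) := by exact_mod_cast hdf
  have hD : (0 : ℚ) < ((s - d f : ℕ) : ℚ) := by rw [Nat.cast_sub hdf.le]; linarith
  rw [← add_div, lt_div_iff₀ hD, one_mul, Nat.cast_sub hdf.le]
  have : ((s : ℕ) : ℚ) < (d f : ℚ) + (d u : ℚ) + (d v : ℚ) := by exact_mod_cast hgt
  linarith

/-- Points have non-negative coordinates. [folklore] -/
theorem nonneg_of_mem_pts {σ : Type*} {H : MvPolynomial σ K} {s : ℕ} {f u v : σ} {x : ℚ × ℚ} (hx : x ∈ pts s f u v H) :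
    0 ≤ x.1 ∧ 0 ≤ x.2 := by
  obtain ⟨d, _, _, rfl⟩ := mem_pts.mp hx
  unfold pt
  exact ⟨div_nonneg (Nat.cast_nonneg _) (Nat.cast_nonneg _), div_nonneg (Nat.cast_nonneg _) (Nat.cast_nonneg _)⟩

/-- Swapping the two slots swaps the coordinates. [folklore] -/
theorem mem_pts_swap {σ : Type*} {H : MvPolynomial σ K} {s : ℕ} {f u v : σ} {x : ℚ × ℚ} (hx : x ∈ pts s f v u H) :
    x.swap ∈ pts s f u v H := by
  obtain ⟨d, hd, hdf, rfl⟩ := mem_pts.mp hx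
  exact mem_pts.mpr ⟨d, hd, hdf, rfl⟩

/-- A monomial `y^d` lies in `(y_u, y_f)^{d_u + d_f}`. [folklore] -/
theorem monomial_mem_span_pow {σ : Type*} {u f : σ} (huf : u ≠ f) (d : σ →₀ ℕ) (r : K) :
    monomial d r ∈ Ideal.span {(X u : MvPolynomial σ K), X f} ^ (d u + d f) := by
  classical
  have hexp : Finsupp.single u (d u) + Finsupp.single f (d f) + (d - Finsupp.single u (d u) - Finsupp.single f (d f)) = d := by
    ext i
    simp only [Finsupp.add_apply, Finsupp.tsub_apply, Finsupp.single_apply]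
    by_cases hiu : u = i
    · subst hiu; rw [if_pos rfl, if_neg (Ne.symm huf)]; omega
    · rw [if_neg hiu]
      by_cases hif : f = i
      · subst hif; rw [if_pos rfl]; omega
      · rw [if_neg hif]; omega
  have hdec : monomial d r = X u ^ d u * X f ^ d f * monomial (d - Finsupp.single u (d u) - Finsupp.single f (d f)) r := by
    rw [X_pow_eq_monomial, X_pow_eq_monomial, monomial_mul, monomial_mul, one_mul, one_mul, hexp]
  rw [hdec, pow_add]
  refine Ideal.mul_mem_right _ _ (Ideal.mul_mem_mul ?_ ?_)
  · exact Ideal.pow_mem_pow (Ideal.subset_span (by simp)) _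
  · exact Ideal.pow_mem_pow (Ideal.subset_span (by simp)) _

/-- If every monomial of `H` has `d_u + d_f ≥ s` then `H ∈ (y_u, y_f)^s`. [folklore] -/
theorem mem_span_pow_of_forall {σ : Type*} {u f : σ} (huf : u ≠ f) {s : ℕ} {H : MvPolynomial σ K}
    (h : ∀ d ∈ H.support, s ≤ d u + d f) : H ∈ Ideal.span {(X u : MvPolynomial σ K), X f} ^ s := by
  rw [H.as_sum]
  refine Ideal.sum_mem _ fun d hd => ?_
  exact Ideal.pow_le_pow_right (h d hd) (monomial_mem_span_pow huf d _)

/-- The shear `y_f ↦ y_f + a y_u + b y_v` maps `(y_u, y_f)` onto `(y_u, y_f + a y_u + b y_v)`. [folklore] -/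
theorem map_zshear_span {σ : Type*} [DecidableEq σ] {u v f : σ} (huf : u ≠ f) (a b : K) :
    Ideal.map (WallFrames.zshear f (C a * X u + C b * X v)).toRingHom (Ideal.span {(X u : MvPolynomial σ K), X f}) =
      Ideal.span {(X u : MvPolynomial σ K), X f + C a * X u + C b * X v} := by
  rw [Ideal.map_span]
  congr 1
  ext P
  simp only [Set.image_insert_eq, Set.image_singleton, AlgHom.toRingHom_eq_coe, RingHom.coe_coe,
    WallFrames.zshear_X_of_ne huf, WallFrames.zshear_X_self, Set.mem_insert_iff, Set.mem_singleton_iff]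
  rw [← add_assoc]

/-- A coordinate `< 1` of a point is `≤ 1 − 1/s` (denominators are `≤ s`). [folklore] -/
theorem fst_le_of_lt_one {σ : Type*} {H : MvPolynomial σ K} {s : ℕ} {f u v : σ} {x : ℚ × ℚ} (hx : x ∈ pts s f u v H)
    (h1 : x.1 < 1) : x.1 ≤ 1 - 1 / (s : ℚ) := by
  obtain ⟨d, _, hdf, rfl⟩ := mem_pts.mp hx
  unfold pt at h1 ⊢
  simp only at h1 ⊢
  have hD : (0 : ℚ) < ((s - d f : ℕ) : ℚ) := by exact_mod_cast Nat.sub_pos_of_lt hdf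
  rw [div_lt_iff₀ hD, one_mul] at h1
  have h2 : d u < s - d f := by exact_mod_cast h1
  have h3 : (d u : ℚ) ≤ ((s - d f : ℕ) : ℚ) - 1 := by
    have : d u + 1 ≤ s - d f := h2
    have : ((d u : ℕ) : ℚ) + 1 ≤ ((s - d f : ℕ) : ℚ) := by exact_mod_cast this
    linarith
  have hs : ((s - d f : ℕ) : ℚ) ≤ (s : ℚ) := by exact_mod_cast Nat.sub_le s (d f)
  have hs0 : (0 : ℚ) < (s : ℚ) := lt_of_lt_of_le hD hs
  rw [div_le_iff₀ hD]
  have : 1 / (s : ℚ) * ((s - d f : ℕ) : ℚ) ≤ 1 := by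
    rw [one_div, inv_mul_le_iff₀ hs0]; linarith
  nlinarith

/-- Lattice gap: a point of `Δ(H; u,v; f)` with ordinate `< 1` has ordinate `≤ 1 − 1/s` (its denominator is `s − d_f ≤ s`); Cossart–Jannsen–Saito 2020, proof of Lemma 12.1. [cite: CossartJannsenSaito2020, Lemma 12.1 p.133] -/
theorem snd_le_of_lt_one {σ : Type*} {H : MvPolynomial σ K} {s : ℕ} {f u v : σ} {x : ℚ × ℚ} (hx : x ∈ pts s f u v H)
    (h1 : x.2 < 1) : x.2 ≤ 1 - 1 / (s : ℚ) := by
  obtain ⟨d, hd, hdf, rfl⟩ := mem_pts.mp hx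
  have hx' : (pt s f u v d).swap ∈ pts s f v u H := mem_pts.mpr ⟨d, hd, hdf, rfl⟩
  exact fst_le_of_lt_one hx' h1

end Frame

section IsolationLaw

variable {K : Type} [Field K]

/-- **ISOLATION LAW (slot 1).**  If the origin is isolated in the `s`-fold locus of `G = σ(H)`, `σ : y_f ↦ y_f + a y_u + b y_v`,
then some point of `Δ(H; u, v; f)` has first coordinate `< 1` — otherwise `H ∈ (y_u, y_f)^s`, `G ∈ (y_u, ℓ)^s` and the curve
`{y_u = ℓ = 0}` is `s`-fold.  [cite: CossartJannsenSaito2020, Lemma 7.5(2)/Def 7.7 pp.99–101] -/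
theorem exists_fst_lt_one {u v f : Fin 3} (huv : u ≠ v) (huf : u ≠ f) (hvf : v ≠ f) (a b : K) {s : ℕ}
    {H : MvPolynomial (Fin 3) K} (hiso : NearCut.IsolatedMult s (WallFrames.zshear f (C a * X u + C b * X v) H)) :
    ∃ x ∈ pts s f u v H, x.1 < 1 := by
  by_contra hcon
  push Not at hcon
  apply not_isolatedMult_of_mem_pow huv huf hvf a b _ hiso
  rw [← map_zshear_span huf a b]
  have hH : H ∈ Ideal.span {(X u : MvPolynomial (Fin 3) K), X f} ^ s := by
    refine mem_span_pow_of_forall huf fun d hd => ?_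
    by_cases hdf : d f < s
    · have h1 := hcon _ (pt_mem_pts hd hdf)
      unfold pt at h1
      simp only at h1
      have hD : (0 : ℚ) < ((s - d f : ℕ) : ℚ) := by exact_mod_cast Nat.sub_pos_of_lt hdf
      rw [le_div_iff₀ hD, one_mul] at h1
      have h2 : s - d f ≤ d u := by exact_mod_cast h1
      omega
    · omega
  have := Ideal.mem_map_of_mem (WallFrames.zshear f (C a * X u + C b * X v)).toRingHom hH
  rwa [Ideal.map_pow] at this

/-- **ISOLATION LAW (slot 2)**, by symmetry. [cite: CossartJannsenSaito2020, Def 7.7 p.101] -/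
theorem exists_snd_lt_one {u v f : Fin 3} (huv : u ≠ v) (huf : u ≠ f) (hvf : v ≠ f) (a b : K) {s : ℕ}
    {H : MvPolynomial (Fin 3) K} (hiso : NearCut.IsolatedMult s (WallFrames.zshear f (C a * X u + C b * X v) H)) :
    ∃ x ∈ pts s f u v H, x.2 < 1 := by
  rw [add_comm] at hiso
  obtain ⟨x, hx, h1⟩ := exists_fst_lt_one (Ne.symm huv) hvf huf b a hiso
  exact ⟨x.swap, mem_pts_swap hx, h1⟩

end IsolationLaw

end Summit.ResolutionOfSingularities.ResolutionOfSingularities.Theorems.WildDescent
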